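import Summits.KontsevichZagierPeriods.KontsevichZagierPeriods.Theorems.SymplecticScissorsRealOnePeriodRelationsStubRetractionCases
import Summits.KontsevichZagierPeriods.KontsevichZagierPeriods.Theorems.SymplecticScissorsRealOnePeriodRelationsStubRetractionPaths

/-!
# `CurvePeriodsTransfer` (stmt-KontsevichZagierPeriods-11129, route SymplecticScissors):
# the cases of the retraction `Θ` (helper file for the stub `stub_realisation`)

The realisation `Θ` of the transfer (the registered stub `stub_realisation` of this item; landed in the
closing file `…SymplecticScissorsCurvePeriodsTransfer.lean`) is built along CHOSEN `ℚ`-semialgebraic `C¹`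
representatives `γ̃ = rep Z hZ γ ≃ γ` of the paths of the symbols: for an algebraic scalar `b`,
`Θ b (Z, ω, γ) := [∫₀¹ Re(b · Σᵢ ωᵢ(γ̃) γ̃ᵢ′)]` (a chosen realisation `rc`). This file proves, for any such
data `rep, rc, Θ` (hypotheses `hrepSA`, `hrepHom`, `hrc`, `hΘ`) and under the hypotheses of the sibling
line `nash-retraction-thin-strip` of stmt-KontsevichZagierPeriods-10042 — homotopy COHERENCE `hcoh`,
EXACTNESS in dimension one `hexact`, REALISATIONS `hreal` — that `Θ` is additive in `b` modulo `M₁`, agrees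
modulo `M₁` with realisations along any semialgebraic path homotopic to `s.γ`, and kills `a • ρ` for every
elementary relation `ρ` of Huber–Wüstholz and algebraic `a` (`kill`): (R1) rule 1b along the common path
`γ̃` (`RetractionAlgebra`); (R2) the velocity of `γ̃` is tangent to `Z`; (R3) Newton–Leibniz in dimension
one plus coherence on `𝔸¹` (`RetractionCases.exact_case`; the end points of `γ̃` are those of `γ`);
(R4) the chain rule plus coherence on `Z′` through `f ∘ γ̃ ≃ f ∘ γ = γ′ ≃ γ̃′`
(`RetractionCases.pushforward_case`, `RetractionPaths.homotopic_map`); (R5)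
`ẽ₀₁ ⋆ ẽ₁₂ ≃ e₀₁ ⋆ e₁₂ ≃ e₀₂ ≃ ẽ₀₂` (`RetractionConcat.homotopic_concat / homotopic_triangle`) plus
`RetractionCases.boundary_case`. §1 adds `T(−c) = −T c`, `T(c₁ − c₂) = T c₁ − T c₂` to the additive
extension `T c = [Σ_{s ∈ supp c} Θ (c s) s] ∈ FormalRep ⧸ M₁` of `RetractionAlgebra` §3.

References: A. Huber, G. Wüstholz, *Transcendence and Linear Relations of 1-Periods* (CUP 2022),
Thm 13.3 (2), §13.1 (A)–(B), §3.3.1; M. Kontsevich, D. Zagier, *Periods* (2001), §1.2.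
-/

noncomputable section

open scoped BigOperators unitInterval
open Set MeasureTheory MvPolynomial
open Literature.NumberTheory.Transcendental Literature.NumberTheory.Transcendental.CurvePeriods
open Literature.ModelTheory.ExponentialFields (IsSemialgebraic)
open Summit.KontsevichZagierPeriods.SymplecticScissors.RealOnePeriodRelationsNegative (M₁)
open Summit.KontsevichZagierPeriods.SymplecticScissors.RealOnePeriodRelations

namespace Summit.KontsevichZagierPeriods.SymplecticScissors.CurvePeriodsTransfer

namespace Retraction

/-! ## §1 Formal complements to `RetractionAlgebra` §3 -/

section Formal

variable (Θ : ℂ → PeriodSymbol → KZ.FormalRep)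

/-- Coefficients of a difference of combinations with algebraic coefficients are algebraic. [folklore] -/
theorem isAlgebraic_sub_apply {c₁ c₂ : PeriodSymbol →₀ ℂ} (h₁ : ∀ s, IsAlgebraic ℚ (c₁ s))
    (h₂ : ∀ s, IsAlgebraic ℚ (c₂ s)) (s : PeriodSymbol) : IsAlgebraic ℚ ((c₁ - c₂) s) := by
  rw [Finsupp.sub_apply]
  exact (h₁ s).sub (h₂ s)

/-- Coefficients of a sum of combinations with algebraic coefficients are algebraic. [folklore] -/
theorem isAlgebraic_add_apply {c₁ c₂ : PeriodSymbol →₀ ℂ} (h₁ : ∀ s, IsAlgebraic ℚ (c₁ s))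
    (h₂ : ∀ s, IsAlgebraic ℚ (c₂ s)) (s : PeriodSymbol) : IsAlgebraic ℚ ((c₁ + c₂) s) := by
  rw [Finsupp.add_apply]
  exact (h₁ s).add (h₂ s)

/-- **The additive extension on a negative**: `T(−c) = −T(c)` for combinations with algebraic
coefficients. [folklore] -/
theorem mk_sum_neg (hΘ0 : ∀ s, Θ 0 s ∈ M₁)
    (hΘadd : ∀ (s : PeriodSymbol) (b₁ b₂ : ℂ), IsAlgebraic ℚ b₁ → IsAlgebraic ℚ b₂ →
      Θ (b₁ + b₂) s - Θ b₁ s - Θ b₂ s ∈ M₁)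
    (c : PeriodSymbol →₀ ℂ) (h : ∀ s, IsAlgebraic ℚ (c s)) :
    QuotientAddGroup.mk' M₁ ((-c).sum fun s b => Θ b s) = - QuotientAddGroup.mk' M₁ (c.sum fun s b => Θ b s) := by
  have hneg : ∀ s, IsAlgebraic ℚ ((-c) s) := fun s => by rw [Finsupp.neg_apply]; exact (h s).neg
  have hadd := RetractionAlgebra.mk_sum_add Θ hΘ0 hΘadd c (-c) h hneg
  rw [add_neg_cancel, Finsupp.sum_zero_index, map_zero] at hadd
  exact (neg_eq_of_add_eq_zero_right hadd.symm).symm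

/-- **The additive extension on a difference**: `T(c₁ − c₂) = T(c₁) − T(c₂)` for combinations with
algebraic coefficients. [folklore] -/
theorem mk_sum_sub (hΘ0 : ∀ s, Θ 0 s ∈ M₁)
    (hΘadd : ∀ (s : PeriodSymbol) (b₁ b₂ : ℂ), IsAlgebraic ℚ b₁ → IsAlgebraic ℚ b₂ →
      Θ (b₁ + b₂) s - Θ b₁ s - Θ b₂ s ∈ M₁)
    (c₁ c₂ : PeriodSymbol →₀ ℂ) (h₁ : ∀ s, IsAlgebraic ℚ (c₁ s)) (h₂ : ∀ s, IsAlgebraic ℚ (c₂ s)) :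
    QuotientAddGroup.mk' M₁ ((c₁ - c₂).sum fun s b => Θ b s) =
      QuotientAddGroup.mk' M₁ (c₁.sum fun s b => Θ b s) - QuotientAddGroup.mk' M₁ (c₂.sum fun s b => Θ b s) := by
  have hneg : ∀ s, IsAlgebraic ℚ ((-c₂) s) := fun s => by rw [Finsupp.neg_apply]; exact (h₂ s).neg
  rw [sub_eq_add_neg, RetractionAlgebra.mk_sum_add Θ hΘ0 hΘadd c₁ (-c₂) h₁ hneg,
    mk_sum_neg Θ hΘ0 hΘadd c₂ h₂, ← sub_eq_add_neg]

end Formal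

/-! ## §2 The retraction along chosen semialgebraic representatives -/

section Cases

variable {rep : ∀ (Z : CurveData), Z.IsSmoothAffineCurve → CurvePath Z → CurvePath Z}
variable {rc : ∀ (s : PeriodSymbol) (b : ℂ), IsAlgebraic ℚ b → KZ.IntegralRep 1}
variable {Θ : ℂ → PeriodSymbol → KZ.FormalRep}

variable
  (hrepSA : ∀ (Z : CurveData) (hZ : Z.IsSmoothAffineCurve) (γ : CurvePath Z),
    IsSemialgebraicMapOn ℚ {z : Fin 1 → ℝ | z 0 ∈ Set.Icc (0 : ℝ) 1}
      (fun z => Fin.append (fun i => ((rep Z hZ γ).toFun (z 0) i).re) (fun i => ((rep Z hZ γ).toFun (z 0) i).im)))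
  (hrepHom : ∀ (Z : CurveData) (hZ : Z.IsSmoothAffineCurve) (γ : CurvePath Z),
    ∃ (x y : Z.points) (p p' : Path x y), (∀ t : I, γ.toFun t = p t) ∧
      (∀ t : I, (rep Z hZ γ).toFun t = p' t) ∧ p.Homotopic p')
  (hrc : ∀ (s : PeriodSymbol) (b : ℂ) (hb : IsAlgebraic ℚ b),
    (rc s b hb).domain = {z | z 0 ∈ Set.Ioo (0 : ℝ) 1} ∧ ∀ z ∈ (rc s b hb).domain, (rc s b hb).integrand z =
      (b * ∑ i, MvPolynomial.eval ((rep s.Z s.smooth s.γ).toFun (z 0)) (s.ω i) *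
        deriv (fun u => (rep s.Z s.smooth s.γ).toFun u i) (z 0)).re)
  (hΘ : ∀ (s : PeriodSymbol) (b : ℂ) (hb : IsAlgebraic ℚ b), Θ b s = KZ.of (rc s b hb))
  (hcoh : ∀ (Z : CurveData) (_hZ : Z.IsSmoothAffineCurve) (ω : Fin Z.n → MvPolynomial (Fin Z.n) ℂ),
      (∀ i, HasAlgCoeffs (ω i)) → ∀ (a : ℂ), IsAlgebraic ℚ a →
      ∀ (γ₀ γ₁ : CurvePath Z),
        IsSemialgebraicMapOn ℚ {z : Fin 1 → ℝ | z 0 ∈ Set.Icc (0 : ℝ) 1}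
          (fun z => Fin.append (fun i => (γ₀.toFun (z 0) i).re) (fun i => (γ₀.toFun (z 0) i).im)) →
        IsSemialgebraicMapOn ℚ {z : Fin 1 → ℝ | z 0 ∈ Set.Icc (0 : ℝ) 1}
          (fun z => Fin.append (fun i => (γ₁.toFun (z 0) i).re) (fun i => (γ₁.toFun (z 0) i).im)) →
        (∃ (x y : Z.points) (p₀ p₁ : Path x y), (∀ t : I, γ₀.toFun t = p₀ t) ∧ (∀ t : I, γ₁.toFun t = p₁ t) ∧
          p₀.Homotopic p₁) →
      ∀ (r₀ r₁ : KZ.IntegralRep 1),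
        (r₀.domain = {z | z 0 ∈ Set.Ioo (0 : ℝ) 1} ∧ ∀ z ∈ r₀.domain, r₀.integrand z =
          (a * ∑ i, MvPolynomial.eval (γ₀.toFun (z 0)) (ω i) * deriv (fun u => γ₀.toFun u i) (z 0)).re) →
        (r₁.domain = {z | z 0 ∈ Set.Ioo (0 : ℝ) 1} ∧ ∀ z ∈ r₁.domain, r₁.integrand z =
          (a * ∑ i, MvPolynomial.eval (γ₁.toFun (z 0)) (ω i) * deriv (fun u => γ₁.toFun u i) (z 0)).re) →
        KZ.of r₀ - KZ.of r₁ ∈ M₁)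
  (hexact : ∀ (u : ℝ → ℝ), IsSemialgebraicFunOn ℚ {z : Fin 1 → ℝ | z 0 ∈ Set.Icc (0 : ℝ) 1}
        (fun z => u (z 0)) → ContDiffOn ℝ 1 u (Set.Icc (0 : ℝ) 1) →
      ∀ (r r' : KZ.IntegralRep 1), r.domain = {z | z 0 ∈ Set.Ioo (0 : ℝ) 1} →
        r'.domain = {z | z 0 ∈ Set.Ioo (0 : ℝ) 1} →
        (∀ z ∈ r.domain, r.integrand z = deriv u (z 0)) → (∀ z ∈ r'.domain, r'.integrand z = u 1 - u 0) →
        KZ.of r - KZ.of r' ∈ M₁)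
  (hreal : ∀ (Z : CurveData) (γ : CurvePath Z),
      IsSemialgebraicMapOn ℚ {z : Fin 1 → ℝ | z 0 ∈ Set.Icc (0 : ℝ) 1}
        (fun z => Fin.append (fun i => (γ.toFun (z 0) i).re) (fun i => (γ.toFun (z 0) i).im)) →
      ∀ (ω : Fin Z.n → MvPolynomial (Fin Z.n) ℂ), (∀ i, HasAlgCoeffs (ω i)) → ∀ (a : ℂ), IsAlgebraic ℚ a →
      ∃ r : KZ.IntegralRep 1, r.domain = {z | z 0 ∈ Set.Ioo (0 : ℝ) 1} ∧ ∀ z ∈ r.domain, r.integrand z =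
        (a * ∑ i, MvPolynomial.eval (γ.toFun (z 0)) (ω i) * deriv (fun u => γ.toFun u i) (z 0)).re)

include hrc hΘ in
/-- **The scalar `0`**: `Θ 0 s ∈ M₁` (zero integrand). [cite: KontsevichZagier2001, §1.2] -/
theorem theta_zero (s : PeriodSymbol) : Θ 0 s ∈ M₁ := by
  rw [hΘ s 0 isAlgebraic_zero]
  exact RetractionAlgebra.realises_zero_scalar _ s.ω _ (hrc s 0 isAlgebraic_zero)

include hrc hΘ in
/-- **Additivity in the scalar** modulo `M₁` (rule 1b along the chosen path).
[cite: KontsevichZagier2001, §1.2 rule (1)] -/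
theorem theta_add (s : PeriodSymbol) (b₁ b₂ : ℂ) (h₁ : IsAlgebraic ℚ b₁) (h₂ : IsAlgebraic ℚ b₂) :
    Θ (b₁ + b₂) s - Θ b₁ s - Θ b₂ s ∈ M₁ := by
  rw [hΘ s _ (h₁.add h₂), hΘ s _ h₁, hΘ s _ h₂]
  exact RetractionAlgebra.realises_add_scalar _ s.ω b₁ b₂ _ _ _ (hrc s _ (h₁.add h₂)) (hrc s _ h₁) (hrc s _ h₂)

include hrepSA hrepHom hrc hΘ hcoh in
/-- **Coherence of the retraction with realisations**: for an algebraic scalar `b`, a `ℚ`-semialgebraic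
`C¹` path `δ` on `s.Z` homotopic (with fixed end points) to `s.γ`, and any realisation `r` of `b · (s.Z, s.ω, δ)`,
`Θ b s − [r] ∈ M₁` — the chosen representative `γ̃ ≃ s.γ ≃ δ` and homotopy coherence.
[cite: HuberWustholz2022, §3.3.1] -/
theorem theta_sub_real (s : PeriodSymbol) (b : ℂ) (hb : IsAlgebraic ℚ b) (δ : CurvePath s.Z)
    (hδ : IsSemialgebraicMapOn ℚ {z : Fin 1 → ℝ | z 0 ∈ Set.Icc (0 : ℝ) 1}
      (fun z => Fin.append (fun i => (δ.toFun (z 0) i).re) (fun i => (δ.toFun (z 0) i).im)))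
    (hhom : ∃ (x y : s.Z.points) (p p' : Path x y), (∀ t : I, s.γ.toFun t = p t) ∧
      (∀ t : I, δ.toFun t = p' t) ∧ p.Homotopic p')
    (r : KZ.IntegralRep 1)
    (hr : r.domain = {z | z 0 ∈ Set.Ioo (0 : ℝ) 1} ∧ ∀ z ∈ r.domain, r.integrand z =
      (b * ∑ i, MvPolynomial.eval (δ.toFun (z 0)) (s.ω i) * deriv (fun u => δ.toFun u i) (z 0)).re) :
    Θ b s - KZ.of r ∈ M₁ := by
  rw [hΘ s b hb]
  exact hcoh s.Z s.smooth s.ω s.ω_algebraic b hb (rep s.Z s.smooth s.γ) δ (hrepSA s.Z s.smooth s.γ) hδ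
    (RetractionPaths.homotopic_trans (RetractionPaths.homotopic_symm (hrepHom s.Z s.smooth s.γ)) hhom)
    (rc s b hb) r (hrc s b hb) hr

include hrc hΘ in
/-- **(R1a)** `Θ a (Z, ω₁ + ω₂, γ) ≡ Θ a (Z, ω₁, γ) + Θ a (Z, ω₂, γ)`: the three symbols share the chosen
path `γ̃`, and `Re` is additive (rule 1b). [cite: HuberWustholz2022, §13.1 (A)] -/
theorem case_add (Z : CurveData) (hZ : Z.IsSmoothAffineCurve) (γ : CurvePath Z)
    (ω ω₁ ω₂ : Fin Z.n → MvPolynomial (Fin Z.n) ℂ) (h : ∀ i, HasAlgCoeffs (ω i))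
    (h₁ : ∀ i, HasAlgCoeffs (ω₁ i)) (h₂ : ∀ i, HasAlgCoeffs (ω₂ i)) (hω : ω = ω₁ + ω₂)
    (a : ℂ) (ha : IsAlgebraic ℚ a) :
    Θ a ⟨Z, hZ, ω, h, γ⟩ - Θ a ⟨Z, hZ, ω₁, h₁, γ⟩ - Θ a ⟨Z, hZ, ω₂, h₂, γ⟩ ∈ M₁ := by
  subst hω
  rw [hΘ _ a ha, hΘ _ a ha, hΘ _ a ha]
  exact RetractionAlgebra.realises_add_form (rep Z hZ γ).toFun ω₁ ω₂ a _ _ _ (hrc ⟨Z, hZ, ω₁ + ω₂, h, γ⟩ a ha)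
    (hrc ⟨Z, hZ, ω₁, h₁, γ⟩ a ha) (hrc ⟨Z, hZ, ω₂, h₂, γ⟩ a ha)

include hrc hΘ in
/-- **(R1b)** `Θ a (Z, a′ • ω, γ) ≡ Θ (a′ a) (Z, ω, γ)`: same path, same integrand.
[cite: HuberWustholz2022, §13.1 (A)] -/
theorem case_smul (Z : CurveData) (hZ : Z.IsSmoothAffineCurve) (γ : CurvePath Z) (a' : ℂ)
    (ha' : IsAlgebraic ℚ a') (ω ω' : Fin Z.n → MvPolynomial (Fin Z.n) ℂ)
    (h : ∀ i, HasAlgCoeffs (ω i)) (h' : ∀ i, HasAlgCoeffs (ω' i)) (hω : ω' = a' • ω)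
    (a : ℂ) (ha : IsAlgebraic ℚ a) :
    Θ a ⟨Z, hZ, ω', h', γ⟩ - Θ (a' * a) ⟨Z, hZ, ω, h, γ⟩ ∈ M₁ := by
  subst hω
  rw [hΘ _ a ha, hΘ _ (a' * a) (ha'.mul ha)]
  exact RetractionAlgebra.realises_smul_form (rep Z hZ γ).toFun ω a' a _ _ (hrc ⟨Z, hZ, a' • ω, h', γ⟩ a ha)
    (hrc ⟨Z, hZ, ω, h, γ⟩ (a' * a) (ha'.mul ha))

include hrc hΘ in
/-- **(R2)** `Θ a (Z, ω, γ) ∈ M₁` when `ω` vanishes on `Z`: the velocity of the chosen `C¹` path `γ̃` on `Z`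
is tangent to `Z`. [cite: HuberWustholz2022, §13.1 (A)] -/
theorem case_vanish (Z : CurveData) (hZ : Z.IsSmoothAffineCurve) (γ : CurvePath Z)
    (ω : Fin Z.n → MvPolynomial (Fin Z.n) ℂ) (h : ∀ i, HasAlgCoeffs (ω i)) (hv : VanishesOn Z ω)
    (a : ℂ) (ha : IsAlgebraic ℚ a) :
    Θ a ⟨Z, hZ, ω, h, γ⟩ ∈ M₁ := by
  rw [hΘ _ a ha]
  exact RetractionAlgebra.realises_vanish (rep Z hZ γ) ω hv a _ (hrc ⟨Z, hZ, ω, h, γ⟩ a ha)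

include hrepSA hrepHom hrc hΘ hcoh hexact in
/-- **(R3)** `Θ a (Z, dP, γ) ≡ Θ (a e) 𝟙` with `e = P(γ(1)) − P(γ(0))`: Newton–Leibniz in dimension one along
`γ̃` (whose end points are those of `γ`) and coherence on `𝔸¹` between the chosen representative of the unit
path and the unit path. [cite: HuberWustholz2022, §13.1 (A)] -/
theorem case_exact (Z : CurveData) (hZ : Z.IsSmoothAffineCurve) (γ : CurvePath Z)
    (P : MvPolynomial (Fin Z.n) ℂ) (hP : HasAlgCoeffs P)
    (ω : Fin Z.n → MvPolynomial (Fin Z.n) ℂ) (h : ∀ i, HasAlgCoeffs (ω i)) (hω : ω = formD P)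
    (a : ℂ) (ha : IsAlgebraic ℚ a)
    (hae : IsAlgebraic ℚ (a * (MvPolynomial.eval (γ.toFun 1) P - MvPolynomial.eval (γ.toFun 0) P))) :
    Θ a ⟨Z, hZ, ω, h, γ⟩ -
      Θ (a * (MvPolynomial.eval (γ.toFun 1) P - MvPolynomial.eval (γ.toFun 0) P)) PeriodSymbol.unit ∈ M₁ := by
  subst hω
  rw [hΘ _ a ha, hΘ _ _ hae]
  have hend := RetractionCases.endpoints_of_homotopic (hrepHom Z hZ γ)
  have hr₁ := hrc PeriodSymbol.unit _ hae
  refine RetractionCases.exact_case hcoh hexact P hP a ha (rep Z hZ γ) (hrepSA Z hZ γ)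
    (rep CurveData.affineLine CurveData.isSmoothAffineCurve_affineLine unitPath)
    (hrepSA CurveData.affineLine CurveData.isSmoothAffineCurve_affineLine unitPath)
    (RetractionPaths.homotopic_symm
      (hrepHom CurveData.affineLine CurveData.isSmoothAffineCurve_affineLine unitPath))
    _ _ (hrc ⟨Z, hZ, formD P, h, γ⟩ a ha) ⟨hr₁.1, fun z hz => ?_⟩
  rw [hr₁.2 z hz, hend.1, hend.2]
  rfl

include hrepSA hrepHom hrc hΘ hcoh hreal in
/-- **(R4)** `Θ a (Z, f^*ω′, γ) ≡ Θ a (Z′, ω′, γ′)` for `γ′ = f ∘ γ` on `[0,1]`: the chain rule along `γ̃` and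
coherence on `Z′` through `f ∘ γ̃ ≃ f ∘ γ = γ′ ≃ γ̃′`. [cite: HuberWustholz2022, §13.1 (B)] -/
theorem case_pushforward (Z Z' : CurveData) (hZ : Z.IsSmoothAffineCurve) (hZ' : Z'.IsSmoothAffineCurve)
    (f : Fin Z'.n → MvPolynomial (Fin Z.n) ℂ) (hf : ∀ j, HasAlgCoeffs (f j))
    (hfZ : ∀ z ∈ Z.points, (fun j => MvPolynomial.eval z (f j)) ∈ Z'.points)
    (ω' : Fin Z'.n → MvPolynomial (Fin Z'.n) ℂ) (h' : ∀ j, HasAlgCoeffs (ω' j))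
    (ω : Fin Z.n → MvPolynomial (Fin Z.n) ℂ) (h : ∀ i, HasAlgCoeffs (ω i))
    (hω : ω = formPullback f ω')
    (γ : CurvePath Z) (γ' : CurvePath Z')
    (hγ' : ∀ t ∈ Set.Icc (0 : ℝ) 1, γ'.toFun t = fun j => MvPolynomial.eval (γ.toFun t) (f j))
    (a : ℂ) (ha : IsAlgebraic ℚ a) :
    Θ a ⟨Z, hZ, ω, h, γ⟩ - Θ a ⟨Z', hZ', ω', h', γ'⟩ ∈ M₁ := by
  subst hω
  rw [hΘ _ a ha, hΘ _ a ha]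
  refine RetractionCases.pushforward_case hcoh hreal hZ' f hf hfZ ω' h' a ha (rep Z hZ γ) (hrepSA Z hZ γ)
    (rep Z' hZ' γ') (hrepSA Z' hZ' γ') (fun δ hδ => ?_) _ _ (hrc ⟨Z, hZ, formPullback f ω', h, γ⟩ a ha)
    (hrc ⟨Z', hZ', ω', h', γ'⟩ a ha)
  -- `δ = f ∘ γ̃ ≃ γ′` (image of `γ̃ ≃ γ`), then `γ′ ≃ γ̃′`
  exact RetractionPaths.homotopic_trans
    (RetractionPaths.homotopic_map f hfZ (RetractionPaths.homotopic_symm (hrepHom Z hZ γ)) δ γ'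
      (fun t _ => hδ t) hγ')
    (hrepHom Z' hZ' γ')

include hrepSA hrepHom hrc hΘ hcoh hreal in
/-- **(R5)** `Θ a e₀₁ + Θ a e₁₂ − Θ a e₀₂ ∈ M₁` for the edges of a `C¹` triangle `τ : Δ → Z`: the chosen
representatives satisfy `ẽ₀₁ ⋆ ẽ₁₂ ≃ e₀₁ ⋆ e₁₂ ≃ e₀₂ ≃ ẽ₀₂`, so concatenation in the move world and
coherence apply. [cite: HuberWustholz2022, §3.3.1] -/
theorem case_boundary (Z : CurveData) (hZ : Z.IsSmoothAffineCurve)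
    (ω : Fin Z.n → MvPolynomial (Fin Z.n) ℂ) (h : ∀ i, HasAlgCoeffs (ω i))
    (τ : ℝ × ℝ → (Fin Z.n → ℂ)) (hτ : ContDiffOn ℝ 1 τ stdTriangle)
    (hτZ : Set.MapsTo τ stdTriangle Z.points)
    (e₀₁ e₁₂ e₀₂ : CurvePath Z)
    (h₀₁ : ∀ t ∈ Set.Icc (0 : ℝ) 1, e₀₁.toFun t = τ (t, 0))
    (h₁₂ : ∀ t ∈ Set.Icc (0 : ℝ) 1, e₁₂.toFun t = τ (1 - t, t))
    (h₀₂ : ∀ t ∈ Set.Icc (0 : ℝ) 1, e₀₂.toFun t = τ (0, t))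
    (a : ℂ) (ha : IsAlgebraic ℚ a) :
    Θ a ⟨Z, hZ, ω, h, e₀₁⟩ + Θ a ⟨Z, hZ, ω, h, e₁₂⟩ - Θ a ⟨Z, hZ, ω, h, e₀₂⟩ ∈ M₁ := by
  rw [hΘ _ a ha, hΘ _ a ha, hΘ _ a ha]
  have hI0 : (0 : ℝ) ∈ Set.Icc (0 : ℝ) 1 := ⟨le_rfl, zero_le_one⟩
  have hI1 : (1 : ℝ) ∈ Set.Icc (0 : ℝ) 1 := ⟨zero_le_one, le_rfl⟩
  -- the junctions
  have hj0 : e₀₁.toFun 1 = e₁₂.toFun 0 := by rw [h₀₁ 1 hI1, h₁₂ 0 hI0, sub_zero]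
  have hend₀₁ := RetractionCases.endpoints_of_homotopic (hrepHom Z hZ e₀₁)
  have hend₁₂ := RetractionCases.endpoints_of_homotopic (hrepHom Z hZ e₁₂)
  have hj : (rep Z hZ e₀₁).toFun 1 = (rep Z hZ e₁₂).toFun 0 := by rw [← hend₀₁.2, hj0, hend₁₂.1]
  -- `ẽ₀₁ ⋆ ẽ₁₂ ≃ e₀₁ ⋆ e₁₂ ≃ e₀₂ ≃ ẽ₀₂`
  have hhom : ∃ (x y : Z.points) (p p' : Path x y),
      (∀ t : I, ((rep Z hZ e₀₁).concat (rep Z hZ e₁₂) hj).toFun t = p t) ∧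
      (∀ t : I, (rep Z hZ e₀₂).toFun t = p' t) ∧ p.Homotopic p' :=
    RetractionPaths.homotopic_trans
      (RetractionPaths.homotopic_trans
        (RetractionConcat.homotopic_concat hj hj0 (RetractionPaths.homotopic_symm (hrepHom Z hZ e₀₁))
          (RetractionPaths.homotopic_symm (hrepHom Z hZ e₁₂)))
        (RetractionPaths.homotopic_symm
          (RetractionConcat.homotopic_triangle τ hτ.continuousOn hτZ e₀₁ e₁₂ e₀₂ h₀₁ h₁₂ h₀₂ hj0)))
      (hrepHom Z hZ e₀₂)
  exact RetractionCases.boundary_case hcoh hreal hZ ω h a ha (rep Z hZ e₀₁) (rep Z hZ e₁₂) (rep Z hZ e₀₂) hj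
    (hrepSA Z hZ e₀₁) (hrepSA Z hZ e₁₂) (hrepSA Z hZ e₀₂) hhom _ _ _ (hrc ⟨Z, hZ, ω, h, e₀₁⟩ a ha)
    (hrc ⟨Z, hZ, ω, h, e₁₂⟩ a ha) (hrc ⟨Z, hZ, ω, h, e₀₂⟩ a ha)

include hrepSA hrepHom hrc hΘ hcoh hexact hreal in
/-- **The retraction kills `a • ρ` for every elementary relation `ρ` and algebraic `a`**, and `a • ρ` has
algebraic coefficients (case analysis R1–R5; the additive extension of `RetractionAlgebra` §3 evaluates the
formal sum symbol by symbol). [cite: HuberWustholz2022, Thm 13.3 (2), §13.1] -/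
theorem kill {ρ : PeriodSymbol →₀ ℂ} (hρ : IsElementaryRelation ρ) {a : ℂ} (ha : IsAlgebraic ℚ a) :
    (∀ s, IsAlgebraic ℚ ((a • ρ) s)) ∧ QuotientAddGroup.mk' M₁ ((a • ρ).sum fun s b => Θ b s) = 0 := by
  have hΘ0 : ∀ s, Θ 0 s ∈ M₁ := theta_zero hrc hΘ
  have hΘadd : ∀ (s : PeriodSymbol) (b₁ b₂ : ℂ), IsAlgebraic ℚ b₁ → IsAlgebraic ℚ b₂ →
      Θ (b₁ + b₂) s - Θ b₁ s - Θ b₂ s ∈ M₁ := theta_add hrc hΘ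
  have hsing : ∀ {b : ℂ}, IsAlgebraic ℚ b → ∀ (s s' : PeriodSymbol),
      IsAlgebraic ℚ ((b • Finsupp.single s (1 : ℂ)) s') :=
    fun hb s s' => RetractionAlgebra.isAlgebraic_smul_single_apply hb s s'
  cases hρ with
  | add Z hZ γ ω ω₁ ω₂ h h₁ h₂ hω =>
    rw [smul_sub, smul_sub]
    refine ⟨isAlgebraic_sub_apply (isAlgebraic_sub_apply (hsing ha _) (hsing ha _)) (hsing ha _), ?_⟩
    rw [mk_sum_sub Θ hΘ0 hΘadd _ _ (isAlgebraic_sub_apply (hsing ha _) (hsing ha _)) (hsing ha _),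
      mk_sum_sub Θ hΘ0 hΘadd _ _ (hsing ha _) (hsing ha _),
      RetractionAlgebra.mk_sum_smul_single Θ hΘ0, RetractionAlgebra.mk_sum_smul_single Θ hΘ0,
      RetractionAlgebra.mk_sum_smul_single Θ hΘ0, ← map_sub, ← map_sub, RetractionAlgebra.mk'_eq_zero_iff]
    exact case_add hrc hΘ Z hZ γ ω ω₁ ω₂ h h₁ h₂ hω a ha
  | smul Z hZ γ a' ha' ω ω' h h' hω =>
    rw [smul_sub, smul_smul, mul_comm a a']
    refine ⟨isAlgebraic_sub_apply (hsing ha _) (hsing (ha'.mul ha) _), ?_⟩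
    rw [mk_sum_sub Θ hΘ0 hΘadd _ _ (hsing ha _) (hsing (ha'.mul ha) _),
      RetractionAlgebra.mk_sum_smul_single Θ hΘ0, RetractionAlgebra.mk_sum_smul_single Θ hΘ0, ← map_sub,
      RetractionAlgebra.mk'_eq_zero_iff]
    exact case_smul hrc hΘ Z hZ γ a' ha' ω ω' h h' hω a ha
  | vanish Z hZ γ ω h hv =>
    refine ⟨hsing ha _, ?_⟩
    rw [RetractionAlgebra.mk_sum_smul_single Θ hΘ0, RetractionAlgebra.mk'_eq_zero_iff]
    exact case_vanish hrc hΘ Z hZ γ ω h hv a ha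
  | exact Z hZ γ P hP ω h hω =>
    have he : IsAlgebraic ℚ (MvPolynomial.eval (γ.toFun 1) P - MvPolynomial.eval (γ.toFun 0) P) :=
      (hP.isAlgebraic_eval γ.algebraic_one).sub (hP.isAlgebraic_eval γ.algebraic_zero)
    rw [smul_sub, smul_smul]
    refine ⟨isAlgebraic_sub_apply (hsing ha _) (hsing (ha.mul he) _), ?_⟩
    rw [mk_sum_sub Θ hΘ0 hΘadd _ _ (hsing ha _) (hsing (ha.mul he) _),
      RetractionAlgebra.mk_sum_smul_single Θ hΘ0, RetractionAlgebra.mk_sum_smul_single Θ hΘ0, ← map_sub,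
      RetractionAlgebra.mk'_eq_zero_iff]
    exact case_exact hrepSA hrepHom hrc hΘ hcoh hexact Z hZ γ P hP ω h hω a ha (ha.mul he)
  | pushforward Z Z' hZ hZ' f hf hfZ ω' h' ω h hω γ γ' hγ' =>
    rw [smul_sub]
    refine ⟨isAlgebraic_sub_apply (hsing ha _) (hsing ha _), ?_⟩
    rw [mk_sum_sub Θ hΘ0 hΘadd _ _ (hsing ha _) (hsing ha _),
      RetractionAlgebra.mk_sum_smul_single Θ hΘ0, RetractionAlgebra.mk_sum_smul_single Θ hΘ0, ← map_sub,
      RetractionAlgebra.mk'_eq_zero_iff]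
    exact case_pushforward hrepSA hrepHom hrc hΘ hcoh hreal Z Z' hZ hZ' f hf hfZ ω' h' ω h hω γ γ' hγ' a ha
  | boundary Z hZ ω h τ hτ hτZ e₀₁ e₁₂ e₀₂ h₀₁ h₁₂ h₀₂ =>
    rw [smul_sub, smul_add]
    refine ⟨isAlgebraic_sub_apply (isAlgebraic_add_apply (hsing ha _) (hsing ha _)) (hsing ha _), ?_⟩
    rw [mk_sum_sub Θ hΘ0 hΘadd _ _ (isAlgebraic_add_apply (hsing ha _) (hsing ha _)) (hsing ha _),
      RetractionAlgebra.mk_sum_add Θ hΘ0 hΘadd _ _ (hsing ha _) (hsing ha _),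
      RetractionAlgebra.mk_sum_smul_single Θ hΘ0, RetractionAlgebra.mk_sum_smul_single Θ hΘ0,
      RetractionAlgebra.mk_sum_smul_single Θ hΘ0, ← map_add, ← map_sub, RetractionAlgebra.mk'_eq_zero_iff]
    exact case_boundary hrepSA hrepHom hrc hΘ hcoh hreal Z hZ ω h τ hτ hτZ e₀₁ e₁₂ e₀₂ h₀₁ h₁₂ h₀₂ a ha

end Cases

end Retraction

/-- HELPER ANCHOR of this file (registered on stmt-KontsevichZagierPeriods-11129): the additive extension
`T c = [Σ_{s ∈ supp c} Θ (c s) s] ∈ FormalRep ⧸ M₁` of a scalar-additive `Θ` on differences of combinations with algebraic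
coefficients, `T(c₁ − c₂) = T c₁ − T c₂`. [folklore] -/
theorem helper_realisationCases_mkSumSub : ∀ (Θ : ℂ → PeriodSymbol → KZ.FormalRep), (∀ s, Θ 0 s ∈ M₁) → (∀ (s : PeriodSymbol) (b₁ b₂ : ℂ), IsAlgebraic ℚ b₁ → IsAlgebraic ℚ b₂ → Θ (b₁ + b₂) s - Θ b₁ s - Θ b₂ s ∈ M₁) → ∀ (c₁ c₂ : PeriodSymbol →₀ ℂ), (∀ s, IsAlgebraic ℚ (c₁ s)) → (∀ s, IsAlgebraic ℚ (c₂ s)) → (QuotientAddGroup.mk' M₁) ((c₁ - c₂).sum fun s b => Θ b s) = (QuotientAddGroup.mk' M₁) (c₁.sum fun s b => Θ b s) - (QuotientAddGroup.mk' M₁) (c₂.sum fun s b => Θ b s) :=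
  fun Θ hΘ0 hΘadd c₁ c₂ h₁ h₂ => Retraction.mk_sum_sub Θ hΘ0 hΘadd c₁ c₂ h₁ h₂

end Summit.KontsevichZagierPeriods.SymplecticScissors.CurvePeriodsTransfer

end
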